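import Summits.BirchSwinnertonDyer.Rank1Residual.Additive.GoodModelReductionLine
import Summits.BirchSwinnertonDyer.Rank1Residual.Additive.RamifiedOrdinaryLineQuotientInvariantsModelFree
import Literature.NumberTheory.EllipticCurves.GeomPointsGaloisModule
import HarnessLib

/-!
# An element of `(ker κ)_v` moving `E[p]/C[p]` for a good model with an ordinary point at a BAD
# place `v ∋ p`, `p` odd — the hypothesis `hmove` of row T-T3B's END, in p05's F-A2 currency
# (team n1011, row T-T3B; seat p12 GEN 8; file F6a)

HONEST FRAMING (cell `b2b-bsdres`, run/shared/lean/b2b/bsd-rank1-residual/, verbatim in every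
file): the goal of the cell is to DELETE the COMBINATION-SHAPED residual classes of the
Birch–Swinnerton-Dyer formula for ALL analytic-rank `≤ 1` elliptic curves over `ℚ` — "full BSD
formula for every rank `≤ 1` curve in class `C`" assembled STRICTLY from published theorems — so
that the rank-`≤ 1` remainder becomes exactly the CONSTRUCTION-SHAPED classes, which are TYPED
(missing-input `Prop`s), NOT attempted. This is not "finishing BSD". Team n1011 (N10/N11; row
T-T3B, skeleton `cells/n1011/skel/T-T3B.md`): research routes on CONSTRUCTION-SHAPED classes;
prove what is provable now; no claim beyond stated classes; census output = EVIDENCE, never a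
Literature fact; RESIDUAL-MAP marks UNCHANGED; nothing is booked by this file. TOOL THEOREMS ONLY:
no definition, no named fact, nothing cited enters as a hypothesis.

## What

For `E = W/ℚ` elliptic, `p` an ODD prime, `v ∋ p` a place of BAD reduction, a good model
`W₀ = C • E ⊗ K̄_v` with an ordinary point (p05 T-ROL-G F-A2/F-A3: `hW₀`, `hΔ`, `red`, `hred`, `hord`),
and ANY `ℤ_p`-extension `κ` of `ℚ`:

  `GoodModelLine.exists_mem_localSubgroup_ker_smul_sub_red_ne_zero :
     ∃ σ ∈ (ker κ)_v, ∃ P ∈ E(K̄_v)[p], red (σ • P − P) ≠ Õ`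

— an element of the local group of `K̄_v / ℚ_v ℚ_∞` (indeed of its inertia group) MOVES the
quotient `E[p]/C[p]` of the `p`-torsion by the canonical line. Proof: the good-model line is a
ramified ordinary line (F-A3 `isRamifiedOrdinaryLine_of_goodModel`), whose quotient `E[p^∞]/C` has a
`p`-torsion class moved by an inertia element INSIDE `ker κ` (p12 GEN 6
`RamifiedOrdinaryLineQuotientModelFree.exists_inertia_mem_kerSubgroup_smul_torsionBy_ne`: the quotient
character has finite order prime to... acts through a finite cyclic quotient non-trivially, and an
element of `I_v ∩ ker κ` still acts non-trivially mod `p` for `p` odd); lift the class to a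
`p`-TORSION point using the divisibility of `C`, and read "moved modulo `C`" as "`red ∘ Φ_C` of the
difference is non-zero" through F-A2's dictionary `m ∈ C ↔ red (ι m) = Õ`. This is the hypothesis
`hmove` of `GoodModelLine.localTowerKerPrimary_zero_eq_bot_of_goodModel`
(`Additive/LocalTowerKernelAtPTwistedOrdinary`, row file F5): on every additive potentially good
ordinary row the étale quotient character `ω^i`, `i = (p−1)·v_p(Δ)/12 ≢ 0 (mod p−1)`, is
non-trivial on the inertia above `ℚ_{p,∞}`.

References: [GreenbergLNM1716] R. Greenberg, LNM 1716 (1999), §2 p. 70, §3 Lemma 3.4 (p. 89);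
[GreenbergVatsal2000] R. Greenberg, V. Vatsal, Invent. Math. 142 (2000) §2 Remark (2.9);
[SerreTate1968] J.-P. Serre, J. Tate, Ann. of Math. 88 (1968) §2.
-/

noncomputable section

open scoped Classical NNReal

open WeierstrassCurve

universe u

namespace Summit.BirchSwinnertonDyer.Rank1Residual.Additive.GoodModelLine

open NumberField IsDedekindDomain Field IsDedekindDomain.HeightOneSpectrum
  Literature.NumberTheory.GaloisRepresentations
  Literature.NumberTheory.EllipticCurves
  Literature.NumberTheory.EllipticCurves.GreenbergSelmer
  Literature.NumberTheory.EllipticCurves.EmertonPollackWeston2006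
  Summit.BirchSwinnertonDyer.Rank1Residual.X2.GreenbergVatsalReductionDatum
  Summit.BirchSwinnertonDyer.Rank1Residual.X2.GreenbergVatsalTateDatumCofree

section Local

variable (W : WeierstrassCurve ℚ) [W.IsElliptic] (p : ℕ) [hp : Fact p.Prime]
  {v : HeightOneSpectrum (𝓞 ℚ)}
  {C : VariableChange (AlgebraicClosure (v.adicCompletion ℚ))}
  {W₀ : WeierstrassCurve (specVal v).integer}
  (hW₀ : C • (W.baseChange (v.adicCompletion ℚ)).baseChange (AlgebraicClosure (v.adicCompletion ℚ)) =
    W₀.baseChange (AlgebraicClosure (v.adicCompletion ℚ)))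
  (hΔ : IsUnit W₀.Δ)
  (red : localPoints W (v.adicCompletion ℚ) →+
    (W₀.map (IsLocalRing.residue (specVal v).integer)).toAffine.Point)
  (hred : ∀ P, red P = goodReductionHom W₀ (Valuation.integer.integers (specVal v)) hΔ
    (Affine.Point.congrEquiv hW₀ (VariableChange.pointEquiv _ C
      (Affine.Point.congrEquiv (baseChange_baseChange_adicCompletion W v).symm P))))

include hred in
/-- **`hmove` for a good ordinary model at a bad place, `p` odd, any `ℤ_p`-extension.** There are
`σ ∈ (ker κ)_v = (Γ_{ℚ_v} → Γ_ℚ)⁻¹(ker κ)` and `P ∈ E(K̄_v)` with `p • P = 0` and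
`red (σ • P − P) ≠ Õ`: the quotient `E[p]/C[p]` by the `p`-torsion of the kernel of reduction of the
good model is MOVED inside the local group of `ℚ_v ℚ_∞`. From F-A2
`exists_localDatum_mem_iff_red_eq_zero` (the line as a local datum `Lv`, `m ∈ Lv.plus ↔ red (ι m) = Õ`),
F-A3 `isRamifiedOrdinaryLine_of_goodModel`, and p12 GEN 6
`RamifiedOrdinaryLineQuotientModelFree.exists_inertia_mem_kerSubgroup_smul_torsionBy_ne` (an
inertia element inside `ker κ` moving a `p`-torsion class of `E[p^∞]/C`), lifting the class to a
`p`-torsion point by the divisibility of `C`. [cite: GreenbergLNM1716, §3 Lemma 3.4 (p. 89)]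
[cite: GreenbergVatsal2000, §2 Remark (2.9)] -/
theorem exists_mem_localSubgroup_ker_smul_sub_red_ne_zero (hpv : ((p : ℕ) : 𝓞 ℚ) ∈ v.asIdeal)
    (hp2 : p ≠ 2)
    (hord : ∃ P : (W₀.baseChange (AlgebraicClosure (v.adicCompletion ℚ))).toAffine.Point,
      (p : ℤ) • P = 0 ∧ goodReductionHom W₀ (Valuation.integer.integers (specVal v)) hΔ P ≠ 0)
    (hbad : ¬ W.HasGoodReductionAt v) (κ : ZpExtension ℚ p) :
    ∃ σ ∈ localSubgroup κ.kerSubgroup (v.adicCompletion ℚ),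
      ∃ P : localPoints W (v.adicCompletion ℚ), p • P = 0 ∧ red (σ • P - P) ≠ 0 := by
  obtain ⟨Lv, hLv⟩ := exists_localDatum_mem_iff_red_eq_zero W p hW₀ hΔ red hred
  have hL : IsRamifiedOrdinaryLine W p Lv :=
    isRamifiedOrdinaryLine_of_goodModel W p hW₀ hΔ red hred hord Lv hLv hpv hbad
  obtain ⟨τ, -, hτker, d, hpd, hτd⟩ :=
    RamifiedOrdinaryLineQuotientModelFree.exists_inertia_mem_kerSubgroup_smul_torsionBy_ne
      (L := Lv) hp2 hL κ
  obtain ⟨m, rfl⟩ := Lv.grMk_surjective d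
  -- `p • m ∈ C`; divide inside `C` to get a `p`-torsion lift `m₀` of the class
  have hpm : p • m ∈ Lv.plus := by
    rw [← LocalDatum.ker_grMk, AddMonoidHom.mem_ker, map_nsmul]; exact hpd
  obtain ⟨m', hm', hpm'⟩ := hL.1 (p • m) hpm
  have hm'0 : Lv.grMk m' = 0 := by
    rw [← AddMonoidHom.mem_ker, LocalDatum.ker_grMk]; exact hm'
  set m₀ : W.geomPrimaryTorsion p := m - m' with hm₀
  have hm₀p : p • m₀ = 0 := by rw [hm₀, smul_sub, hpm', sub_self]
  have hgr : Lv.grMk m₀ = Lv.grMk m := by rw [hm₀, map_sub, hm'0, sub_zero]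
  -- `τ` moves the class of `m₀`
  have hnot : absGaloisRestrict ℚ (v.adicCompletion ℚ) τ • m₀ - m₀ ∉ Lv.plus := by
    intro hmem
    apply hτd
    rw [← hgr, LocalDatum.smul_grMk, ← sub_eq_zero, ← map_sub, ← AddMonoidHom.mem_ker,
      LocalDatum.ker_grMk]
    exact hmem
  refine ⟨τ, ?_, pointsMap W (v.adicCompletion ℚ) (m₀ : W.geomPoints), ?_, fun h ↦ hnot ?_⟩
  · rw [mem_localSubgroup_iff, resGal_eq_absGaloisRestrict]; exact hτker
  · rw [← map_nsmul, ← AddSubmonoidClass.coe_nsmul, hm₀p, ZeroMemClass.coe_zero, map_zero]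
  · rw [hLv, AddSubgroupClass.coe_sub, map_sub]
    change red (pointsMap W (v.adicCompletion ℚ)
      (absGaloisRestrict ℚ (v.adicCompletion ℚ) τ • (m₀ : W.geomPoints)) -
        pointsMap W (v.adicCompletion ℚ) (m₀ : W.geomPoints)) = 0
    rw [pointsMap_absGaloisRestrict_smul]
    exact h

end Local

end Summit.BirchSwinnertonDyer.Rank1Residual.Additive.GoodModelLine

end
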